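import Summits.ABC.ABC.Theses.DefiniteXi
import HarnessLib

/-!
# Route DefiniteXi — assembly item `Assembly` (stmt-ABC-11339)

The assembly item of route `DefiniteXi` mirrors the route's deciding theorem `closes`
(D-0027 §2.1):

> `XiStrongBound → DefiniteRTControlPrime → DefiniteGlue → FreyModularity →
>  MinimalBoundGivesTarget → PeterssonLowerBound → DegreeBoundToABCOfPetersson → ABC`.

It is pure modus ponens: `DefiniteGlue` turns the two definite-side cruxes (`XiStrongBound`,
`DefiniteRTControlPrime`) into the degree bound for minimal parametrisation data;
`MinimalBoundGivesTarget` combines that bound with `FreyModularity` into the thesis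
`FreyDegreeBound`; `DegreeBoundToABCOfPetersson` combines `PeterssonLowerBound` with
`FreyDegreeBound` into `ABC`. No literature input; closes `--workitem stmt-ABC-11339`.
-/

-- `Summit.<Summit>.<Problem>` is the mandated summit-side namespace (CONVENTIONS §2); for the
-- single-conjunct summit `ABC` the two coincide, so the duplicate `ABC.ABC` is deliberate.
set_option linter.dupNamespace false

namespace Summit.ABC.ABC.Theorems

/-- **`Assembly` holds** (route `DefiniteXi`, item stmt-ABC-11339): the chain
`XiStrongBound → DefiniteRTControlPrime → DefiniteGlue → FreyModularity →
MinimalBoundGivesTarget → PeterssonLowerBound → DegreeBoundToABCOfPetersson → ABC`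
is closed by the same modus-ponens term as the route's deciding theorem `closes`:
`hDeg hP (hMin hMod (hGlue hXS hRT))`. -/
theorem assembly_proof : Summit.ABC.ABC.Theses.DefiniteXi.Assembly := by
  unfold Summit.ABC.ABC.Theses.DefiniteXi.Assembly
  intro hXS hRT hGlue hMod hMin hP hDeg
  exact hDeg hP (hMin hMod (hGlue hXS hRT))

end Summit.ABC.ABC.Theorems
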